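import Literature.Analysis.FluidPDE.DistributionalToWeak
import Literature.Analysis.FluidPDE.SuitableWeak
import Literature.Analysis.FunctionSpaces.DistributionalConstancy
import Literature.Analysis.FunctionSpaces.DuBoisReymondAE
import HarnessLib

/-!
# Time pairings of bounded distributional Navier–Stokes solutions against spatial test fields

Support file for the discharge of `Literature.Analysis.FluidPDE.NSSliceTimeContinuity`
(`FluidPDE/NSBoundedInteriorRegularity`): the elementary passage from the space–time
distributional formulation to the time regularity of the pairings
`g_η(t) = ∫_B ⟪u(t, x), η(x)⟫ dx` of a bounded solution against a spatial test field `η`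
supported in the ball `B` of a centred cylinder `Q*_R(z) = I × B`,
`I = ]t₀ - R², t₀ + R²[`, `B = B(x₀, R)`.

* `isSpaceTimeTestOn_prod_smul`, `timeDeriv_prod_smul` — `χ(t) η(x)` is a space–time test
  field on `I × Ω` when `χ ∈ C_c^∞(I)` and `η ∈ C_c^∞(Ω)`, and `∂ₜ(χ η) = χ' η`;
* `volume_restrict_parabolicCylinderCentered`, `integrableOn_of_ae_bound`,
  `integrableOn_pressure_of_lintegral`, `integrable_inner_test`, `integrable_remainder_test` —
  the cylinder as a product of finite measure and the integrability of the tested integrands;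
* `setIntegral_deriv_mul_pairing_add_eq_zero` — testing the momentum equation with `χ(t) η(x)`
  and Fubini: `∫_I (χ' g_η + χ f_η) = 0` with
  `f_η(t) = ∫_B (⟪u, Dη u⟫ + ⟪u, Δη⟫ + p div η)`;
* `setIntegral_deriv_mul_primitive_Ioo` — integration by parts against a primitive on `]a, b[`;
* `exists_ae_eq_const_add_primitive` — the one-dimensional conclusion: `g = c + ∫ₐᵗ f` a.e.
  whenever `∫ (χ' g + χ f) = 0` for all `χ ∈ C_c^∞(]a, b[)` (du Bois-Reymond:
  `Literature.Analysis.FunctionSpaces.ae_eq_const_of_forall_setIntegral_deriv_mul_eq_zero`).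

The continuation (`FluidPDE/NSSliceTimeIncrement`) combines the last two into the a.e.
primitive representation of `g_η` and bounds its increments by the pressure. All of this is
folklore bookkeeping (cf. Robinson–Rodrigo–Sadowski 2016, §13.5, Lemma 13.8:
`‖g(t₂) - g(t₁)‖ ≤ ∫ ‖∂ₜg‖`); nothing here is specific to dimension three except the notation.

## References

* J. C. Robinson, J. L. Rodrigo, W. Sadowski, *The three-dimensional Navier–Stokes equations*
  (CUP 2016), §13.5, Lemma 13.8. [`RobinsonRodrigoSadowskiCUP2016`] -/

noncomputable section

open MeasureTheory Set Function Filter Topology TopologicalSpace Metric intervalIntegral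
open scoped NNReal ENNReal InnerProductSpace RealInnerProductSpace Laplacian

namespace Literature.Analysis.FluidPDE

/-! ### Separated test fields on product regions -/

section ProdTest

variable {X : Type*} [NormedAddCommGroup X] [NormedSpace ℝ X]
variable {F : Type*} [NormedAddCommGroup F] [NormedSpace ℝ F]

/-- The product `χ(s) θ(x)` of a smooth compactly supported `χ` with `supp χ ⊆ I` (`I` open) and
a test function `θ` on an open `Ω ⊆ X` is a space–time test field on `I × Ω`. [folklore] -/
theorem isSpaceTimeTestOn_prod_smul {I : Set ℝ} (hI : IsOpen I) {Ω : Set X} (hΩ : IsOpen Ω)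
    {χ : ℝ → ℝ} (hχ : ContDiff ℝ (⊤ : ℕ∞) χ) (hχc : HasCompactSupport χ) (hχI : tsupport χ ⊆ I)
    {θ : X → F} (hθ : FunctionSpaces.IsTestFunctionOn ⟨Ω, hΩ⟩ θ) :
    IsSpaceTimeTestOn ⟨I ×ˢ Ω, hI.prod hΩ⟩ (fun s x => χ s • θ x) where
  contDiff := (hχ.comp contDiff_fst).smul (hθ.contDiff.comp contDiff_snd)
  hasCompactSupport := by
    refine HasCompactSupport.intro (hχc.prod hθ.hasCompactSupport) ?_
    rintro ⟨s, x⟩ hp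
    rcases not_and_or.1 (fun h => hp (mem_prod.2 h)) with h | h
    · simp [uncurry, image_eq_zero_of_notMem_tsupport h]
    · simp [uncurry, image_eq_zero_of_notMem_tsupport h]
  tsupport_subset := by
    intro q hq
    have h1 : q.1 ∈ tsupport χ := by
      have h1 : q ∈ tsupport fun w : ℝ × X => χ w.1 :=
        tsupport_smul_subset_left (fun w : ℝ × X => χ w.1) (fun w => θ w.2) hq
      have h1' : (tsupport fun w : ℝ × X => χ w.1) ⊆ Prod.fst ⁻¹' tsupport χ :=
        closure_minimal (fun w hw => subset_tsupport _ hw)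
          ((isClosed_tsupport χ).preimage continuous_fst)
      exact h1' h1
    have h2 : q.2 ∈ tsupport θ := by
      have h2 : q ∈ tsupport fun w : ℝ × X => θ w.2 :=
        tsupport_smul_subset_right (fun w : ℝ × X => χ w.1) (fun w => θ w.2) hq
      have h2' : (tsupport fun w : ℝ × X => θ w.2) ⊆ Prod.snd ⁻¹' tsupport θ :=
        closure_minimal (fun w hw => subset_tsupport _ hw)
          ((isClosed_tsupport θ).preimage continuous_snd)
      exact h2' h2
    exact ⟨hχI h1, hθ.tsupport_subset h2⟩

omit [NormedAddCommGroup X] [NormedSpace ℝ X] in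
/-- Time derivative of a separated field: `∂ₜ(χ(t) θ(x)) = χ'(t) θ(x)`. [folklore] -/
theorem timeDeriv_prod_smul {χ : ℝ → ℝ} (hχ : Differentiable ℝ χ) (θ : X → F) (t : ℝ) (x : X) :
    timeDeriv (fun s y => χ s • θ y) t x = deriv χ t • θ x := by
  rw [timeDeriv_apply]
  exact ((hχ t).hasDerivAt.smul_const (θ x)).deriv

end ProdTest

/-! ### The cylinder as a product, integrability -/

section Cylinder

/-- Local notation for physical space `ℝ³ = EuclideanSpace ℝ (Fin 3)`. -/
local notation "ℝ³" => EuclideanSpace ℝ (Fin 3)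

variable {u : ℝ → ℝ³ → ℝ³} {p : ℝ → ℝ³ → ℝ} {z : ℝ × ℝ³} {R M : ℝ}

/-- The centred cylinder is the product of its time window and its ball. [folklore] -/
theorem parabolicCylinderCentered_eq_prod (R : ℝ) (z : ℝ × ℝ³) :
    parabolicCylinderCentered R z = Ioo (z.1 - R ^ 2) (z.1 + R ^ 2) ×ˢ ball z.2 R := rfl

/-- The volume restricted to the centred cylinder is the product of the restricted volumes.
[folklore] -/
theorem volume_restrict_parabolicCylinderCentered (R : ℝ) (z : ℝ × ℝ³) :
    (volume : Measure (ℝ × ℝ³)).restrict (parabolicCylinderCentered R z) =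
      ((volume : Measure ℝ).restrict (Ioo (z.1 - R ^ 2) (z.1 + R ^ 2))).prod
        ((volume : Measure ℝ³).restrict (ball z.2 R)) := by
  rw [parabolicCylinderCentered_eq_prod, Measure.volume_eq_prod, Measure.prod_restrict]

/-- The centred cylinder has finite volume (twin of `volume_parabolicCylinderCentered_lt_top` in
`FluidPDE/CKNEpsilonRegularity`, another import layer). [folklore] -/
theorem parabolicCylinderCentered_volume_lt_top (R : ℝ) (z : ℝ × ℝ³) :
    (volume : Measure (ℝ × ℝ³)) (parabolicCylinderCentered R z) < ∞ := by
  rw [parabolicCylinderCentered_eq_prod, Measure.volume_eq_prod, Measure.prod_prod]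
  exact ENNReal.mul_lt_top measure_Ioo_lt_top measure_ball_lt_top

/-- The volume restricted to the centred cylinder is a finite measure. [folklore] -/
theorem isFiniteMeasure_restrict_parabolicCylinderCentered (R : ℝ) (z : ℝ × ℝ³) :
    IsFiniteMeasure ((volume : Measure (ℝ × ℝ³)).restrict (parabolicCylinderCentered R z)) :=
  ⟨by rw [Measure.restrict_apply_univ]; exact parabolicCylinderCentered_volume_lt_top R z⟩

/-- A distributional solution bounded a.e. on the cylinder is integrable there. [folklore] -/
theorem integrableOn_of_ae_bound
    (hsol : IsDistributionalNSSolutionOn (parabolicCylinderCenteredOpens R z) 1 0 u p)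
    (hbd : ∀ᵐ w ∂(volume.restrict (parabolicCylinderCentered R z)), ‖u w.1 w.2‖ ≤ M) :
    IntegrableOn (uncurry u) (parabolicCylinderCentered R z) volume := by
  haveI := isFiniteMeasure_restrict_parabolicCylinderCentered R z
  have hm : AEStronglyMeasurable (uncurry u) (volume.restrict (parabolicCylinderCentered R z)) :=
    hsol.1.aestronglyMeasurable
  exact (integrable_const M).mono' hm (by simpa [uncurry] using hbd)

/-- `p ∈ L_{3/2}` of the cylinder is integrable on the cylinder (finite volume). [folklore] -/
theorem integrableOn_pressure_of_lintegral
    (hsol : IsDistributionalNSSolutionOn (parabolicCylinderCenteredOpens R z) 1 0 u p)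
    (hp : ∫⁻ w in parabolicCylinderCentered R z, ‖p w.1 w.2‖ₑ ^ (3 / 2 : ℝ) < ∞) :
    IntegrableOn (uncurry p) (parabolicCylinderCentered R z) volume := by
  haveI := isFiniteMeasure_restrict_parabolicCylinderCentered R z
  have hm : AEStronglyMeasurable (uncurry p) (volume.restrict (parabolicCylinderCentered R z)) :=
    hsol.2.2.1.aestronglyMeasurable
  have h32 : (3 / 2 : ℝ≥0∞) = ENNReal.ofReal (3 / 2) := by
    rw [ENNReal.ofReal_div_of_pos (by norm_num)]; simp
  have hmem : MemLp (uncurry p) (3 / 2 : ℝ≥0∞) (volume.restrict (parabolicCylinderCentered R z)) := by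
    refine ⟨hm, ?_⟩
    rw [eLpNorm_lt_top_iff_lintegral_rpow_enorm_lt_top (by norm_num) (by rw [h32]; simp)]
    rw [h32, ENNReal.toReal_ofReal (by norm_num)]
    simpa [uncurry] using hp
  exact hmem.integrable (by rw [h32]; exact ENNReal.one_le_ofReal.2 (by norm_num))

/-! ### Testing the momentum equation with `χ(t) η(x)` -/

/-- The Laplacian of a compactly supported field is compactly supported (twin of
`hasCompactSupport_laplacian` of `FluidPDE/LerayHopfMild`, another import layer). [folklore] -/
theorem hasCompactSupport_laplacian' {η : ℝ³ → ℝ³} (hc : HasCompactSupport η) :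
    HasCompactSupport (Δ η) :=
  hc.mono' fun x hx => by
    by_contra h
    exact hx (laplacian_eq_zero_of_notMem_tsupport h)

/-- Sup bounds for a test field, its derivative and its Laplacian. [folklore] -/
theorem exists_bounds_of_isTestFunctionOn {Ω : Opens ℝ³} {η : ℝ³ → ℝ³}
    (hη : FunctionSpaces.IsTestFunctionOn Ω η) :
    ∃ K₀ K₁ K₂ : ℝ, (∀ x, ‖η x‖ ≤ K₀) ∧ (∀ x, ‖fderiv ℝ η x‖ ≤ K₁) ∧ ∀ x, ‖Δ η x‖ ≤ K₂ := by
  obtain ⟨K₀, hK₀⟩ := hη.contDiff.continuous.bounded_above_of_compact_support hη.hasCompactSupport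
  obtain ⟨K₁, hK₁⟩ := (hη.contDiff.continuous_fderiv (by simp)).bounded_above_of_compact_support
    (hη.hasCompactSupport.fderiv ℝ)
  obtain ⟨K₂, hK₂⟩ := (continuous_laplacian (hη.contDiff.of_le (by norm_cast))
    ).bounded_above_of_compact_support (hasCompactSupport_laplacian' hη.hasCompactSupport)
  exact ⟨K₀, K₁, K₂, hK₀, hK₁, hK₂⟩

/-- The pairing integrand `⟪u, η⟫` is integrable on the cylinder. [folklore] -/
theorem integrable_inner_test
    (hsol : IsDistributionalNSSolutionOn (parabolicCylinderCenteredOpens R z) 1 0 u p)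
    (hbd : ∀ᵐ w ∂(volume.restrict (parabolicCylinderCentered R z)), ‖u w.1 w.2‖ ≤ M)
    {η : ℝ³ → ℝ³} (hηc : Continuous η) {K₀ : ℝ} (hK₀ : ∀ x, ‖η x‖ ≤ K₀) :
    Integrable (fun w : ℝ × ℝ³ => ⟪u w.1 w.2, η w.2⟫)
      (volume.restrict (parabolicCylinderCentered R z)) := by
  have hu := integrableOn_of_ae_bound hsol hbd
  refine Integrable.mono' (hu.norm.mul_const K₀)
    (hu.1.inner (hηc.comp continuous_snd).aestronglyMeasurable) (Eventually.of_forall fun w => ?_)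
  exact (norm_inner_le_norm _ _).trans (mul_le_mul_of_nonneg_left (hK₀ w.2) (norm_nonneg _))

/-- The remaining integrand `⟪u, Dη u⟫ + ⟪u, Δη⟫ + p div η` is integrable on the cylinder.
[folklore] -/
theorem integrable_remainder_test
    (hsol : IsDistributionalNSSolutionOn (parabolicCylinderCenteredOpens R z) 1 0 u p)
    (hbd : ∀ᵐ w ∂(volume.restrict (parabolicCylinderCentered R z)), ‖u w.1 w.2‖ ≤ M)
    (hpi : IntegrableOn (uncurry p) (parabolicCylinderCentered R z) volume)
    {η : ℝ³ → ℝ³} (hη1 : ContDiff ℝ 2 η) {K₁ K₂ : ℝ} (hK₁ : ∀ x, ‖fderiv ℝ η x‖ ≤ K₁)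
    (hK₂ : ∀ x, ‖Δ η x‖ ≤ K₂) :
    Integrable (fun w : ℝ × ℝ³ => ⟪u w.1 w.2, fderiv ℝ η w.2 (u w.1 w.2)⟫ + ⟪u w.1 w.2, Δ η w.2⟫ +
        p w.1 w.2 * VectorCalculus.divergence η w.2)
      (volume.restrict (parabolicCylinderCentered R z)) := by
  have hu := integrableOn_of_ae_bound hsol hbd
  have cD : Continuous (fderiv ℝ η) := hη1.continuous_fderiv (by simp)
  have cL : Continuous (Δ η) := continuous_laplacian hη1
  have hdiv : Continuous (VectorCalculus.divergence η) := continuous_divergence cD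
  have hdivb : ∀ x, ‖VectorCalculus.divergence η x‖ ≤ 3 * K₁ := fun x => by
    set b := EuclideanSpace.basisFun (Fin 3) ℝ
    rw [divergence_eq_sum_inner_fderiv b η x, Real.norm_eq_abs]
    calc |∑ i, ⟪b i, fderiv ℝ η x (b i)⟫|
        ≤ ∑ i, |⟪b i, fderiv ℝ η x (b i)⟫| := Finset.abs_sum_le_sum_abs _ _
      _ ≤ ∑ _i : Fin 3, K₁ := Finset.sum_le_sum fun i _ => ?_
      _ = 3 * K₁ := by simp
    calc |⟪b i, fderiv ℝ η x (b i)⟫| ≤ ‖b i‖ * ‖fderiv ℝ η x (b i)‖ := abs_real_inner_le_norm _ _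
      _ ≤ 1 * (‖fderiv ℝ η x‖ * 1) := by
          rw [b.norm_eq_one i]
          gcongr
          simpa [b.norm_eq_one i] using (fderiv ℝ η x).le_opNorm (b i)
      _ ≤ K₁ := by simpa using hK₁ x
  -- the quadratic term
  have i1 : Integrable (fun w : ℝ × ℝ³ => ⟪u w.1 w.2, fderiv ℝ η w.2 (u w.1 w.2)⟫)
      (volume.restrict (parabolicCylinderCentered R z)) := by
    have hm : AEStronglyMeasurable (fun w : ℝ × ℝ³ => ⟪u w.1 w.2, fderiv ℝ η w.2 (u w.1 w.2)⟫)
        (volume.restrict (parabolicCylinderCentered R z)) :=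
      hu.1.inner (isBoundedBilinearMap_apply.continuous.comp_aestronglyMeasurable
        ((cD.comp continuous_snd).aestronglyMeasurable.prodMk hu.1))
    refine Integrable.mono' (hu.norm.const_mul (K₁ * M)) hm ?_
    filter_upwards [hbd] with w hw
    calc ‖⟪u w.1 w.2, fderiv ℝ η w.2 (u w.1 w.2)⟫‖
        ≤ ‖u w.1 w.2‖ * ‖fderiv ℝ η w.2 (u w.1 w.2)‖ := norm_inner_le_norm _ _
      _ ≤ ‖u w.1 w.2‖ * (K₁ * M) := by
          gcongr
          exact (ContinuousLinearMap.le_opNorm _ _).trans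
            (mul_le_mul (hK₁ w.2) hw (norm_nonneg _) ((norm_nonneg _).trans (hK₁ w.2)))
      _ = K₁ * M * ‖u w.1 w.2‖ := by ring
  -- the Laplacian term
  have i2 : Integrable (fun w : ℝ × ℝ³ => ⟪u w.1 w.2, Δ η w.2⟫)
      (volume.restrict (parabolicCylinderCentered R z)) := by
    refine Integrable.mono' (hu.norm.mul_const K₂)
      (hu.1.inner (cL.comp continuous_snd).aestronglyMeasurable) (Eventually.of_forall fun w => ?_)
    exact (norm_inner_le_norm _ _).trans (mul_le_mul_of_nonneg_left (hK₂ w.2) (norm_nonneg _))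
  -- the pressure term
  have i3 : Integrable (fun w : ℝ × ℝ³ => p w.1 w.2 * VectorCalculus.divergence η w.2)
      (volume.restrict (parabolicCylinderCentered R z)) := by
    have : (fun w : ℝ × ℝ³ => p w.1 w.2 * VectorCalculus.divergence η w.2) =
        fun w => VectorCalculus.divergence η w.2 * uncurry p w := by
      ext w; simp [uncurry, mul_comm]
    rw [this]
    exact hpi.bdd_mul (hdiv.comp continuous_snd).aestronglyMeasurable
      (Eventually.of_forall fun w => hdivb w.2)
  exact (i1.add i2).add i3

/-- **Testing the momentum equation with `χ(t) η(x)`.** For a distributional solution in the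
centred cylinder `Q*_R(z) = I × B`, bounded a.e. by `M`, with integrable pressure, a smooth `χ`
compactly supported in the time window `I` and a test field `η` on the ball `B`,
`∫_I (χ'(t) ∫_B ⟪u(t), η⟫ + χ(t) ∫_B (⟪u, Dη u⟫ + ⟪u, Δη⟫ + p div η)(t)) dt = 0`: the
distributional identity for `ψ = χ ⊗ η` followed by Fubini. [folklore] -/
theorem setIntegral_deriv_mul_pairing_add_eq_zero
    (hsol : IsDistributionalNSSolutionOn (parabolicCylinderCenteredOpens R z) 1 0 u p)
    (hbd : ∀ᵐ w ∂(volume.restrict (parabolicCylinderCentered R z)), ‖u w.1 w.2‖ ≤ M)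
    (hpi : IntegrableOn (uncurry p) (parabolicCylinderCentered R z) volume)
    {χ : ℝ → ℝ} (hχ : ContDiff ℝ (⊤ : ℕ∞) χ) (hχc : HasCompactSupport χ)
    (hχI : tsupport χ ⊆ Ioo (z.1 - R ^ 2) (z.1 + R ^ 2))
    {η : ℝ³ → ℝ³} (hη : FunctionSpaces.IsTestFunctionOn ⟨ball z.2 R, isOpen_ball⟩ η) :
    ∫ t in Ioo (z.1 - R ^ 2) (z.1 + R ^ 2),
      ((deriv χ t * ∫ x in ball z.2 R, ⟪u t x, η x⟫) +
        χ t * ∫ x in ball z.2 R, (⟪u t x, fderiv ℝ η x (u t x)⟫ + ⟪u t x, Δ η x⟫ +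
          p t x * VectorCalculus.divergence η x)) = 0 := by
  obtain ⟨K₀, K₁, K₂, hK₀, hK₁, hK₂⟩ := exists_bounds_of_isTestFunctionOn hη
  have hηd : Differentiable ℝ η := hη.contDiff.differentiable (by simp)
  have hη2 : ContDiff ℝ 2 η := hη.contDiff.of_le (by norm_cast)
  have hχd : Differentiable ℝ χ := hχ.differentiable (by simp)
  obtain ⟨Cχ, hCχ⟩ := hχ.continuous.bounded_above_of_compact_support hχc
  obtain ⟨Cχ', hCχ'⟩ := (hχ.continuous_deriv (by simp)).bounded_above_of_compact_support hχc.deriv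
  -- the distributional identity for `ψ = χ ⊗ η`
  have hψ : IsSpaceTimeTestOn (parabolicCylinderCenteredOpens R z) (fun s x => χ s • η x) :=
    isSpaceTimeTestOn_prod_smul isOpen_Ioo isOpen_ball hχ hχc hχI hη
  have key := hsol.2.2.2.2 _ hψ
  -- the two integrable pieces
  set G : ℝ × ℝ³ → ℝ := fun w => ⟪u w.1 w.2, fderiv ℝ η w.2 (u w.1 w.2)⟫ + ⟪u w.1 w.2, Δ η w.2⟫ +
    p w.1 w.2 * VectorCalculus.divergence η w.2 with hG
  have iU : Integrable (fun w : ℝ × ℝ³ => ⟪u w.1 w.2, η w.2⟫)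
      (volume.restrict (parabolicCylinderCentered R z)) :=
    integrable_inner_test hsol hbd hη.contDiff.continuous hK₀
  have iG : Integrable G (volume.restrict (parabolicCylinderCentered R z)) :=
    integrable_remainder_test hsol hbd hpi hη2 hK₁ hK₂
  have iU' : Integrable (fun w : ℝ × ℝ³ => deriv χ w.1 * ⟪u w.1 w.2, η w.2⟫)
      (volume.restrict (parabolicCylinderCentered R z)) :=
    integrable_time_mul iU (hχ.continuous_deriv (by simp)) (C := Cχ')
      fun s => by simpa [Real.norm_eq_abs] using hCχ' s
  have iG' : Integrable (fun w : ℝ × ℝ³ => χ w.1 * G w)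
      (volume.restrict (parabolicCylinderCentered R z)) :=
    integrable_time_mul iG hχ.continuous (C := Cχ) fun s => by simpa [Real.norm_eq_abs] using hCχ s
  -- rewrite the tested integrand
  have key' : ∫ w in parabolicCylinderCentered R z,
      (deriv χ w.1 * ⟪u w.1 w.2, η w.2⟫ + χ w.1 * G w) = 0 := by
    refine Eq.trans (setIntegral_congr_fun
      (isOpen_parabolicCylinderCentered R z).measurableSet fun w _ => ?_) key
    rw [hG]
    dsimp only
    rw [timeDeriv_prod_smul hχd, convect_fun_const_smul _ (hηd w.2),
      laplacian_fun_const_smul hη2, divergence_fun_const_smul (hηd w.2)]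
    simp only [inner_smul_right, Pi.zero_apply, inner_zero_left, one_mul, convect]
    ring
  -- Fubini
  rw [volume_restrict_parabolicCylinderCentered] at key' iU iG iU' iG'
  have iS : Integrable (fun w : ℝ × ℝ³ => deriv χ w.1 * ⟪u w.1 w.2, η w.2⟫ + χ w.1 * G w)
      (((volume : Measure ℝ).restrict (Ioo (z.1 - R ^ 2) (z.1 + R ^ 2))).prod
        ((volume : Measure ℝ³).restrict (ball z.2 R))) := iU'.add iG'
  rw [integral_prod _ iS] at key'
  have hae : ∀ᵐ t ∂((volume : Measure ℝ).restrict (Ioo (z.1 - R ^ 2) (z.1 + R ^ 2))),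
      (∫ x in ball z.2 R, (deriv χ t * ⟪u t x, η x⟫ + χ t * G (t, x))) =
        (deriv χ t * ∫ x in ball z.2 R, ⟪u t x, η x⟫) +
          χ t * ∫ x in ball z.2 R, (⟪u t x, fderiv ℝ η x (u t x)⟫ + ⟪u t x, Δ η x⟫ +
            p t x * VectorCalculus.divergence η x) := by
    filter_upwards [iU.prod_right_ae, iG.prod_right_ae] with t h1 h2
    rw [integral_add (h1.const_mul _) (h2.const_mul _), MeasureTheory.integral_const_mul,
      MeasureTheory.integral_const_mul]
  rw [← integral_congr_ae hae]
  exact key'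

end Cylinder

/-! ### Integration by parts against a primitive, and the a.e. representation of the pairing -/

section Primitive

/-- **Integration by parts against a primitive on `]a, b[`.** For `F` integrable on `]a, b[` and
a `C¹` function `χ` with `tsupport χ ⊆ ]a, b[`,
`∫_{]a,b[} χ'(t) (∫_{]a,t]} F) dt = -∫_{]a,b[} χ F` (Fubini on the triangle,
`Literature.Analysis.FunctionSpaces.setIntegral_mul_setIntegral_add_symm`). [folklore] -/
theorem setIntegral_deriv_mul_primitive_Ioo {a b : ℝ} {F χ : ℝ → ℝ}
    (hF : IntegrableOn F (Ioo a b)) (hχ : ContDiff ℝ 1 χ) (hχI : tsupport χ ⊆ Ioo a b) :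
    ∫ t in Ioo a b, deriv χ t * ∫ s in Ioc a t, F s = -∫ t in Ioo a b, χ t * F t := by
  rcases le_or_gt b a with hba | hab
  · simp [Ioo_eq_empty_of_le hba]
  have hF' : IntegrableOn F (Ioc a b) :=
    (integrableOn_congr_set_ae (Ioo_ae_eq_Ioc (μ := volume) (a := a) (b := b))).1 hF
  have hdc : Continuous (deriv χ) := hχ.continuous_deriv le_rfl
  have hd : IntegrableOn (deriv χ) (Ioc a b) := hdc.integrableOn_Icc.mono_set Ioc_subset_Icc_self
  have key := FunctionSpaces.setIntegral_mul_setIntegral_add_symm hd hF'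
  have hχa : χ a = 0 := image_eq_zero_of_notMem_tsupport fun h => (lt_irrefl a) (hχI h).1
  have hχb : χ b = 0 := image_eq_zero_of_notMem_tsupport fun h => (lt_irrefl b) (hχI h).2
  have h1 : ∀ r ∈ Ioc a b, ∫ s in Ioc a r, deriv χ s = χ r := fun r hr => by
    rw [← intervalIntegral.integral_of_le hr.1.le,
      intervalIntegral.integral_deriv_eq_sub (fun x _ => (hχ.differentiable one_ne_zero) x)
        (hdc.intervalIntegrable _ _), hχa, sub_zero]
  have h0 : ∫ s in Ioc a b, deriv χ s = 0 := by rw [h1 b ⟨hab, le_rfl⟩, hχb]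
  have h2 : ∫ r in Ioc a b, F r * ∫ s in Ioc a r, deriv χ s = ∫ r in Ioc a b, χ r * F r := by
    refine setIntegral_congr_fun measurableSet_Ioc fun r hr => ?_
    rw [h1 r hr]
    ring
  rw [h2, h0, zero_mul] at key
  rw [setIntegral_congr_set (Ioo_ae_eq_Ioc (μ := volume) (a := a) (b := b)),
    setIntegral_congr_set (Ioo_ae_eq_Ioc (μ := volume) (a := a) (b := b))]
  linarith

/-- **A.e. primitive representation from the weak derivative.** Let `g, f` be integrable on
`]a, b[` with `∫_{]a,b[} (χ' g + χ f) = 0` for every smooth `χ` compactly supported in `]a, b[`.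
Then `g(t) = c + ∫_{]a,t]} f` for a.e. `t ∈ ]a, b[` and some constant `c` (du Bois-Reymond:
`V(t) = ∫_{]a,t]} f` satisfies the same identities by `setIntegral_deriv_mul_primitive_Ioo`, so
`g - V` has vanishing weak derivative and is a.e. constant,
`Literature.Analysis.FunctionSpaces.ae_eq_const_of_forall_setIntegral_deriv_mul_eq_zero`).
[folklore] -/
theorem exists_ae_eq_const_add_primitive {a b : ℝ} {g f : ℝ → ℝ} (hg : IntegrableOn g (Ioo a b))
    (hf : IntegrableOn f (Ioo a b))
    (h : ∀ χ : ℝ → ℝ, ContDiff ℝ (⊤ : ℕ∞) χ → HasCompactSupport χ → tsupport χ ⊆ Ioo a b →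
      ∫ t in Ioo a b, (deriv χ t * g t + χ t * f t) = 0) :
    ∃ c : ℝ, ∀ᵐ t ∂(volume.restrict (Ioo a b)), g t = c + ∫ s in Ioc a t, f s := by
  rcases le_or_gt b a with hba | hab
  · refine ⟨0, ?_⟩
    rw [Ioo_eq_empty_of_le hba, Measure.restrict_empty, ae_zero]
    exact eventually_bot
  set V : ℝ → ℝ := fun t => ∫ s in Ioc a t, f s with hV
  -- `V` is continuous on `[a, b]`, hence integrable on `]a, b[`
  have hfI : IntegrableOn f (Icc a b) := (integrableOn_Icc_iff_integrableOn_Ioo (by simp) (by simp)).2 hf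
  have hVc : ContinuousOn V (Icc a b) := intervalIntegral.continuousOn_primitive hfI
  have hVi : IntegrableOn V (Ioo a b) :=
    (hVc.integrableOn_compact isCompact_Icc).mono_set Ioo_subset_Icc_self
  -- `g - V` has vanishing weak derivative
  have hW : ∀ χ : ℝ → ℝ, ContDiff ℝ (⊤ : ℕ∞) χ → HasCompactSupport χ → tsupport χ ⊆ Ioo a b →
      ∫ t in Ioo a b, deriv χ t * (g t - V t) = 0 := by
    intro χ hχ hχc hχI
    have hdc : Continuous (deriv χ) := hχ.continuous_deriv (by simp)
    have i1 : IntegrableOn (fun t => deriv χ t * g t) (Ioo a b) :=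
      FunctionSpaces.integrableOn_continuous_mul_of_hasCompactSupport hg hdc hχc.deriv
    have i2 : IntegrableOn (fun t => deriv χ t * V t) (Ioo a b) :=
      FunctionSpaces.integrableOn_continuous_mul_of_hasCompactSupport hVi hdc hχc.deriv
    have i3 : IntegrableOn (fun t => χ t * f t) (Ioo a b) :=
      FunctionSpaces.integrableOn_continuous_mul_of_hasCompactSupport hf hχ.continuous hχc
    have e1 := h χ hχ hχc hχI
    rw [integral_add i1 i3] at e1
    have e2 := setIntegral_deriv_mul_primitive_Ioo hf (hχ.of_le (by norm_cast)) hχI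
    have e3 : ∫ t in Ioo a b, deriv χ t * (g t - V t) =
        (∫ t in Ioo a b, deriv χ t * g t) - ∫ t in Ioo a b, deriv χ t * V t := by
      rw [← integral_sub i1 i2]
      exact integral_congr_ae (Eventually.of_forall fun t => by ring)
    rw [e3, e2]
    linarith
  obtain ⟨c, hc⟩ :=
    FunctionSpaces.ae_eq_const_of_forall_setIntegral_deriv_mul_eq_zero (hg.sub hVi) hW
  exact ⟨c, hc.mono fun t ht => by simp only [Pi.sub_apply] at ht; linarith⟩

end Primitive

end Literature.Analysis.FluidPDE
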